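import Literature.NumberTheory.Transcendental.Dolbeault
import Literature.NumberTheory.Transcendental.ComplexLinearForms
import Literature.NumberTheory.Transcendental.DeRhamTheorem
import Literature.Geometry.Kaehler.PluriharmonicLog
import HarnessLib

/-!
# Holomorphic functions are the `∂̄`-closed functions; `h^{0,0} = 1` (discharge of two facts of `Dolbeault.lean`)

Trunk **T-KAEHLER** (`NumberTheory/Transcendental`). Theorems-only leaf companion of
`Dolbeault.lean`, discharging two of its named facts:

* `dolbeaultBar_eq_zero_iff_mdifferentiable` — **holomorphic functions are the `∂̄`-closed
  functions** (Cauchy–Riemann on a complex manifold): for a real `C¹` function `f : M → ℂ`, the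
  `0`-form `x ↦ f x` has `∂̄f = 0` iff `f` is holomorphic (`MDifferentiable 𝓘(ℂ, E) 𝓘(ℂ, ℂ) f`).
  C. Voisin, *Hodge Theory and Complex Algebraic Geometry I* (2002), §2.3.3 with Lemma 2.29;
  P. Griffiths, J. Harris (1978), p. 2; D. Huybrechts (2005), §1.3.
* `hodgeNumber_zero_zero` — **`h^{0,0} = 1`** for a compact connected complex manifold:
  `H^{0,0}_∂̄(M)` is the space of global holomorphic functions, which are constant (Mathlib's
  `MDifferentiable.apply_eq_of_compactSpace`, needing no separation axiom — the fact has none).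
  Voisin (2002), §2.3.3; Griffiths–Harris (1978), p. 25; Huybrechts (2005), §2.6.

The proof is the printed one, pointwise and chart by chart (no bump functions, so no Hausdorff
hypothesis): for a `0`-form `γ` one has `∂̄γ = (dγ)^{0,1}` (`dolbeaultBar_eq_typeComponent_mextDeriv`);
a `1`-form has vanishing `(0,1)`-part iff it is of type `(1,0)` iff it is `ℂ`-linear at every point
(`typeComponent_zero_one_eq_zero_iff_isOfType`, the tree's `isOfType_zero_iff_isComplexLinearForm`);
`d` of the `0`-form of `f` at `x` is the differential of the chart expression
`f ∘ φₓ⁻¹` (`mextDeriv_ofFun_apply`, `PluriharmonicLog.lean`), which is `ℂ`-linear iff that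
chart expression is complex-differentiable (Mathlib's `differentiableAt_iff_restrictScalars`), i.e.
iff `f` is `MDifferentiableAt` for the complex model (the real and complex extended charts agree).

* `dolbeaultBar_ofFun_eq_zero_iff_mdifferentiable` — the theorem, for `f` continuous with
  real-differentiable chart expressions (what the proof uses);
* **`dolbeaultBar_eq_zero_iff_mdifferentiable_holds`** — discharge of the named fact (`C¹` `f`);
* `dolbeaultClosedForms_zero_zero_eq_span_const` — `Z^{0,0}_∂̄(M) = ℂ · 1` for compact connected `M`;
* **`hodgeNumber_zero_zero_holds`** — discharge of `h^{0,0} = 1`.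

No definition and no named fact is introduced (D-0026).

## References

* C. Voisin, *Hodge Theory and Complex Algebraic Geometry I* (2002), §2.3.1, §2.3.3, Lemma 2.29.
  [Voisin2002] [VoisinHodgeI2002]
* P. Griffiths, J. Harris, *Principles of Algebraic Geometry* (1978), pp. 2, 25. [GriffithsHarris1978]
* D. Huybrechts, *Complex Geometry* (2005), §1.3, Prop. 2.6.11. [Huybrechts2005]
-/

noncomputable section

open scoped Manifold ContDiff Topology
open Set Function Filter Finset Module Literature.Geometry.Kaehler

namespace Literature.NumberTheory.Transcendental

-- The identification `TangentSpace I x = E` is an abuse of definitional equality (see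
-- `NormedSpace.fromTangentSpace`); as in Mathlib's tangent-bundle files we let `isDefEq` unfold it.
set_option backward.isDefEq.respectTransparency false

variable {E : Type*} [NormedAddCommGroup E] [NormedSpace ℂ E]
  {M : Type*} [TopologicalSpace M] [ChartedSpace E M]

/-! ### `0`-forms: type `(0,0)`, and `∂̄γ = (dγ)^{0,1}` -/

/-- Every complex `0`-form is of type `(0,0)` (weight `0`: there is no vector to rotate); the same
as `isOfType_zero_zero` of `KaehlerHodgeTypeProofs.lean`, whose import closure (the Kähler Hodge star)
is not wanted here. [cite: Voisin2002, §2.3.1] -/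
theorem isOfType_zero_zero_deg0 (γ : MForm 𝓘(ℝ, E) M ℂ 0) : IsOfType 0 0 γ := by
  refine ⟨rfl, fun x θ v ↦ ?_⟩
  have hv : (fun i ↦ tangentRotate E x θ (v i)) = v := funext fun i ↦ Fin.elim0 i
  rw [hv]
  simp

/-- For a `0`-form `γ`, `∂̄γ = (dγ)^{0,1}` (the only bidegree with `p + q = 0` is `(0,0)`, and
`γ^{0,0} = γ`). [cite: Voisin2002, §2.3.3] -/
theorem dolbeaultBar_eq_typeComponent_mextDeriv (γ : MForm 𝓘(ℝ, E) M ℂ 0) :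
    dolbeaultBar γ = (mextDeriv γ).typeComponent 0 1 := by
  rw [dolbeaultBar, Nat.antidiagonal_zero, sum_singleton]
  simp only
  rw [(isOfType_zero_zero_deg0 γ).typeComponent_eq_self]

/-! ### `1`-forms: vanishing `(0,1)`-part iff type `(1,0)` iff `ℂ`-linear -/

/-- A complex `1`-form has vanishing `(0,1)`-component iff it is of type `(1,0)`
(`β = β^{1,0} + β^{0,1}`). [cite: Voisin2002, §2.3.1] -/
theorem typeComponent_zero_one_eq_zero_iff_isOfType (β : MForm 𝓘(ℝ, E) M ℂ 1) :
    β.typeComponent 0 1 = 0 ↔ IsOfType 1 0 β := by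
  constructor
  · intro h
    have hsum : ∑ pq ∈ antidiagonal 1, β.typeComponent pq.1 pq.2 = β :=
      sum_antidiagonal_typeComponent_holds β
    have h1 : antidiagonal 1 = {((0 : ℕ), (1 : ℕ)), (1, 0)} := by decide
    rw [h1, sum_pair (by decide), h, zero_add] at hsum
    have h10 : IsOfType 1 0 (β.typeComponent 1 0) :=
      isOfType_typeComponent_holds (p := 1) (q := 0) (show 1 + 0 = 1 from rfl) β
    rwa [hsum] at h10
  · intro h
    exact IsOfType.typeComponent_of_ne_holds h (Or.inl one_ne_zero)

/-- A complex `1`-form is of type `(1,0)` iff it is `ℂ`-linear at every point: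
`β(c v) = c β(v)`. [cite: Huybrechts2005, Prop. 1.2.8] -/
theorem isOfType_one_zero_iff_forall_smul (β : MForm 𝓘(ℝ, E) M ℂ 1) :
    IsOfType 1 0 β ↔ ∀ (x : M) (v : TangentSpace 𝓘(ℝ, E) x) (c : ℂ),
      β x ![tangentSMul E x c v] = c * β x ![v] := by
  rw [isOfType_zero_iff_isComplexLinearForm]
  have hupd : ∀ (x : M) (v : Fin 1 → TangentSpace 𝓘(ℝ, E) x) (w : TangentSpace 𝓘(ℝ, E) x),
      update v 0 w = ![w] := by
    intro x v w
    funext i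
    obtain rfl : i = 0 := Subsingleton.elim _ _
    rw [update_self]
    rfl
  have hvec : ∀ (x : M) (v : Fin 1 → TangentSpace 𝓘(ℝ, E) x), v = ![v 0] := by
    intro x v
    funext i
    obtain rfl : i = 0 := Subsingleton.elim _ _
    rfl
  constructor
  · intro h x v c
    have := h x ![v] 0 c
    rwa [hupd] at this
  · intro h x v j c
    obtain rfl : j = 0 := Subsingleton.elim _ _
    rw [hupd, h x (v 0) c, ← hvec x v]

/-! ### The `0`-form of a function: `∂̄f = 0` iff the chart expressions are complex-differentiable -/

section OfFun

variable [IsManifold 𝓘(ℝ, E) ∞ M]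

/-- `d` of the `0`-form of `f` at `x`, on one vector: the real derivative of the chart expression
`f ∘ φₓ⁻¹` at `φₓ x` (`mextDeriv_ofFun_apply` with `range 𝓘(ℝ, E) = univ`).
[cite: WarnerGTM94, 2.20] -/
theorem mextDeriv_ofFun_apply_single (f : M → ℂ) (x : M) (v : TangentSpace 𝓘(ℝ, E) x) :
    mextDeriv (MForm.ofFun 𝓘(ℝ, E) f) x ![v] =
      fderiv ℝ (f ∘ (extChartAt 𝓘(ℝ, E) x).symm) (extChartAt 𝓘(ℝ, E) x x) v := by
  rw [mextDeriv_ofFun_apply]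
  simp only [modelWithCornersSelf_coe, range_id, fderivWithin_univ, Matrix.cons_val_zero]

omit [IsManifold 𝓘(ℝ, E) ∞ M] in
/-- **Cauchy–Riemann in a real Banach space**: a real-differentiable `g : E → ℂ` is
complex-differentiable at `a` iff its real derivative there is `ℂ`-linear (Mathlib's
`differentiableAt_iff_restrictScalars`; Huybrechts (2005), §1.3: `f` is holomorphic iff `df` is
`ℂ`-linear, i.e. commutes with `I`). [cite: Huybrechts2005, §1.3] -/
theorem differentiableAt_complex_iff_forall_fderiv_smul {g : E → ℂ} {a : E}
    (hg : DifferentiableAt ℝ g a) :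
    DifferentiableAt ℂ g a ↔ ∀ (v : E) (c : ℂ), fderiv ℝ g a (c • v) = c * fderiv ℝ g a v := by
  rw [differentiableAt_iff_restrictScalars ℝ hg]
  constructor
  · rintro ⟨L, hL⟩ v c
    rw [← hL, ContinuousLinearMap.coe_restrictScalars', L.map_smul, smul_eq_mul]
  · intro h
    exact ⟨⟨⟨⟨fderiv ℝ g a, fun u w ↦ map_add _ u w⟩, fun c u ↦ by
      rw [RingHom.id_apply, smul_eq_mul]; exact h u c⟩, (fderiv ℝ g a).continuous⟩, rfl⟩

/-- **Pointwise Cauchy–Riemann on the manifold.** For `f : M → ℂ` whose chart expression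
`g = f ∘ φₓ⁻¹` at `x` is real-differentiable at `φₓ x`: `(d f)ₓ` is `ℂ`-linear iff `g` is
complex-differentiable at `φₓ x`. [cite: Voisin2002, §2.3.3 Lemma 2.29] -/
theorem forall_mextDeriv_ofFun_smul_iff_differentiableAt (f : M → ℂ) (x : M)
    (hf : DifferentiableAt ℝ (f ∘ (extChartAt 𝓘(ℝ, E) x).symm) (extChartAt 𝓘(ℝ, E) x x)) :
    (∀ (v : TangentSpace 𝓘(ℝ, E) x) (c : ℂ),
        mextDeriv (MForm.ofFun 𝓘(ℝ, E) f) x ![tangentSMul E x c v] =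
          c * mextDeriv (MForm.ofFun 𝓘(ℝ, E) f) x ![v]) ↔
      DifferentiableAt ℂ (f ∘ (extChartAt 𝓘(ℝ, E) x).symm) (extChartAt 𝓘(ℝ, E) x x) := by
  rw [differentiableAt_complex_iff_forall_fderiv_smul hf]
  constructor
  · intro h v c
    have h' := h v c
    rw [mextDeriv_ofFun_apply_single, mextDeriv_ofFun_apply_single, tangentSMul_apply] at h'
    exact h'
  · intro h v c
    rw [mextDeriv_ofFun_apply_single, mextDeriv_ofFun_apply_single, tangentSMul_apply]
    exact h v c

omit [IsManifold 𝓘(ℝ, E) ∞ M] in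
/-- The complex and the real extended charts of a complex manifold agree (both are the preferred
chart, the model with corners being trivial). [folklore] -/
private theorem extChartAt_complex_eq_real (x : M) : extChartAt 𝓘(ℂ, E) x = extChartAt 𝓘(ℝ, E) x := rfl

omit [IsManifold 𝓘(ℝ, E) ∞ M] in
/-- **Holomorphy at a point in the chart**: for `f : M → ℂ` continuous at `x`, `f` is
`MDifferentiableAt` for the complex model iff its chart expression `f ∘ φₓ⁻¹` is
complex-differentiable at `φₓ x`. [folklore] -/
private theorem mdifferentiableAt_iff_differentiableAt_chart {f : M → ℂ} {x : M} (hc : ContinuousAt f x) :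
    MDifferentiableAt 𝓘(ℂ, E) 𝓘(ℂ, ℂ) f x ↔
      DifferentiableAt ℂ (f ∘ (extChartAt 𝓘(ℝ, E) x).symm) (extChartAt 𝓘(ℝ, E) x x) := by
  rw [mdifferentiableAt_iff]
  simp only [hc, true_and, writtenInExtChartAt, extChartAt_model_space_eq_id, PartialEquiv.refl_coe,
    id_comp, modelWithCornersSelf_coe, range_id, differentiableWithinAt_univ, extChartAt_complex_eq_real]

/-- **`∂̄f = 0` iff `f` is holomorphic**, for `f : M → ℂ` continuous with real-differentiable chart
expressions (pointwise Cauchy–Riemann, assembled): `∂̄` of the `0`-form of `f` vanishes iff `f` is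
`MDifferentiable` for the complex model. [cite: Voisin2002, §2.3.3 Lemma 2.29] -/
theorem dolbeaultBar_ofFun_eq_zero_iff_mdifferentiable {f : M → ℂ} (hc : Continuous f)
    (hd : ∀ x, DifferentiableAt ℝ (f ∘ (extChartAt 𝓘(ℝ, E) x).symm) (extChartAt 𝓘(ℝ, E) x x)) :
    dolbeaultBar (MForm.ofFun 𝓘(ℝ, E) f) = 0 ↔ MDifferentiable 𝓘(ℂ, E) 𝓘(ℂ, ℂ) f := by
  rw [dolbeaultBar_eq_typeComponent_mextDeriv, typeComponent_zero_one_eq_zero_iff_isOfType,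
    isOfType_one_zero_iff_forall_smul]
  constructor
  · intro h x
    exact (mdifferentiableAt_iff_differentiableAt_chart hc.continuousAt).2
      ((forall_mextDeriv_ofFun_smul_iff_differentiableAt f x (hd x)).1 (h x))
  · intro h x
    exact (forall_mextDeriv_ofFun_smul_iff_differentiableAt f x (hd x)).2
      ((mdifferentiableAt_iff_differentiableAt_chart hc.continuousAt).1 (h x))

omit [IsManifold 𝓘(ℝ, E) ∞ M] in
/-- A real `C¹` function has real-differentiable chart expressions. [folklore] -/
private theorem differentiableAt_chart_of_contMDiff {f : M → ℂ} (hf : ContMDiff 𝓘(ℝ, E) 𝓘(ℝ, ℂ) 1 f) (x : M) :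
    DifferentiableAt ℝ (f ∘ (extChartAt 𝓘(ℝ, E) x).symm) (extChartAt 𝓘(ℝ, E) x x) := by
  have h := (contMDiffAt_iff.1 (hf x)).2
  simp only [extChartAt_model_space_eq_id, PartialEquiv.refl_coe, id_comp, modelWithCornersSelf_coe,
    range_id, contDiffWithinAt_univ] at h
  exact h.differentiableAt one_ne_zero

variable [IsManifold 𝓘(ℂ, E) ω M]

/-- **Holomorphic functions are the `∂̄`-closed functions** (discharge of the named fact
`dolbeaultBar_eq_zero_iff_mdifferentiable`): for a real `C¹` function `f : M → ℂ` on a complex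
manifold, the `0`-form `x ↦ f x` satisfies `∂̄f = 0` iff `f` is holomorphic.
[cite: Voisin2002, §2.3.3 Lemma 2.29] -/
theorem dolbeaultBar_eq_zero_iff_mdifferentiable_holds :
    dolbeaultBar_eq_zero_iff_mdifferentiable (E := E) (M := M) := by
  intro f hf
  exact dolbeaultBar_ofFun_eq_zero_iff_mdifferentiable hf.continuous (differentiableAt_chart_of_contMDiff hf)

end OfFun

/-! ### `h^{0,0} = 1` -/

section HodgeNumber

/-- The constant `0`-form `a` is `∂̄`-closed: `∂̄ a = (d a)^{0,1} = 0` (constants are holomorphic).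
[cite: Voisin2002, §2.3.3] -/
theorem dolbeaultBar_const (a : ℂ) : dolbeaultBar (MForm.const 𝓘(ℝ, E) M a) = 0 := by
  rw [dolbeaultBar_eq_typeComponent_mextDeriv, mextDeriv_const, MForm.typeComponent_zero]

/-- The constant `0`-form `a` lies in `Z^{0,0}_∂̄(M)` (constants are holomorphic functions).
[cite: Voisin2002, §2.3.3] -/
theorem const_mem_dolbeaultClosedForms_zero_zero (a : ℂ) :
    MForm.const 𝓘(ℝ, E) M a ∈ dolbeaultClosedForms E M 0 0 :=
  mem_dolbeaultClosedForms (isSmoothForm_const a) (isOfType_zero_zero_deg0 _) (dolbeaultBar_const a)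

variable [IsManifold 𝓘(ℂ, E) ω M] [IsManifold 𝓘(ℝ, E) ∞ M]

/-- **A `∂̄`-closed smooth function on a compact connected complex manifold is constant**: a smooth
`0`-form `γ` with `∂̄γ = 0` is `γ(x₀) · 1` (holomorphic by `dolbeaultBar_ofFun_eq_zero_iff_mdifferentiable`,
constant by Mathlib's `MDifferentiable.apply_eq_of_compactSpace`, which needs neither a Hausdorff
hypothesis nor finite dimension). [cite: Voisin2002, §2.3.3] -/
theorem eq_smul_const_of_dolbeaultBar_eq_zero [CompactSpace M] [PreconnectedSpace M]
    {γ : MForm 𝓘(ℝ, E) M ℂ 0} (hγ : IsSmoothForm γ) (hd : dolbeaultBar γ = 0) (x₀ : M) :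
    γ = γ x₀ default • MForm.const 𝓘(ℝ, E) M (1 : ℂ) := by
  -- `γ` is the `0`-form of the function `f x = γ x ()`
  set f : M → ℂ := fun x ↦ γ x default with hf
  have hγf : γ = MForm.ofFun 𝓘(ℝ, E) f := by
    funext x; ext v
    rw [MForm.ofFun_apply, hf, Subsingleton.elim v default]
  -- chart expressions are `C^∞`, hence differentiable, and `f` is continuous
  have hsm : ∀ x, ContDiffWithinAt ℝ ∞ (f ∘ (extChartAt 𝓘(ℝ, E) x).symm) (range 𝓘(ℝ, E))
      (extChartAt 𝓘(ℝ, E) x x) := fun x ↦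
    (MForm.smoothAt_ofFun_iff f x).1 (by rw [← hγf]; exact hγ x)
  have hdiff : ∀ x, DifferentiableAt ℝ (f ∘ (extChartAt 𝓘(ℝ, E) x).symm) (extChartAt 𝓘(ℝ, E) x x) := by
    intro x
    have h := hsm x
    simp only [modelWithCornersSelf_coe, range_id, contDiffWithinAt_univ] at h
    exact h.differentiableAt (by simp)
  have hcont : Continuous f := by
    refine continuous_iff_continuousAt.2 fun x ↦ ?_
    have h1 : ContinuousAt ((f ∘ (extChartAt 𝓘(ℝ, E) x).symm) ∘ extChartAt 𝓘(ℝ, E) x) x :=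
      (hdiff x).continuousAt.comp (continuousAt_extChartAt x)
    refine h1.congr ?_
    have hsrc : (extChartAt 𝓘(ℝ, E) x).source ∈ 𝓝 x := extChartAt_source_mem_nhds x
    filter_upwards [hsrc] with y hy
    simp only [Function.comp_apply, (extChartAt 𝓘(ℝ, E) x).left_inv hy]
  -- hence `f` is holomorphic, hence constant
  have hhol : MDifferentiable 𝓘(ℂ, E) 𝓘(ℂ, ℂ) f :=
    (dolbeaultBar_ofFun_eq_zero_iff_mdifferentiable hcont hdiff).1 (by rw [← hγf]; exact hd)
  have hconst : ∀ x, f x = f x₀ := fun x ↦ hhol.apply_eq_of_compactSpace x x₀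
  rw [hγf]
  funext x; ext v
  rw [MForm.ofFun_apply, hconst x, Pi.smul_apply, ContinuousAlternatingMap.smul_apply, MForm.const_apply,
    smul_eq_mul, mul_one, MForm.ofFun_apply]

/-- **`Z^{0,0}_∂̄(M) = ℂ · 1`** for a compact connected complex manifold: the `∂̄`-closed smooth
functions are the constants. [cite: Voisin2002, §2.3.3] -/
theorem dolbeaultClosedForms_zero_zero_eq_span_const [CompactSpace M] [ConnectedSpace M] :
    dolbeaultClosedForms E M 0 0 = ℂ ∙ MForm.const 𝓘(ℝ, E) M (1 : ℂ) := by
  obtain ⟨x₀⟩ := (inferInstance : Nonempty M)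
  apply le_antisymm
  · rw [dolbeaultClosedForms, Submodule.span_le]
    rintro γ ⟨hs, -, hd⟩
    rw [SetLike.mem_coe, Submodule.mem_span_singleton]
    exact ⟨γ x₀ default, (eq_smul_const_of_dolbeaultBar_eq_zero hs hd x₀).symm⟩
  · rw [Submodule.span_singleton_le_iff_mem]
    exact const_mem_dolbeaultClosedForms_zero_zero 1

/-- **`h^{0,0} = 1` for a compact connected complex manifold** (discharge of the named fact
`hodgeNumber_zero_zero`): `H^{0,0}_∂̄(M) = Z^{0,0}_∂̄(M) / 0 = ℂ · 1`. [cite: Voisin2002, §2.3.3] -/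
theorem hodgeNumber_zero_zero_holds : hodgeNumber_zero_zero (E := E) (M := M) := by
  intro _ _ _
  obtain ⟨x₀⟩ := (inferInstance : Nonempty M)
  have hne : MForm.const 𝓘(ℝ, E) M (1 : ℂ) ≠ 0 := by
    intro h
    have h1 := congrArg (fun γ : MForm 𝓘(ℝ, E) M ℂ 0 ↦ γ x₀ default) h
    simp only [MForm.const_apply, Pi.zero_apply, ContinuousAlternatingMap.coe_zero] at h1
    exact one_ne_zero h1
  have e := Submodule.quotEquivOfEqBot
    ((dolbeaultExactForms E M 0 0).comap (dolbeaultClosedForms E M 0 0).subtype)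
    (by rw [dolbeaultExactForms_zero, Submodule.comap_bot, Submodule.ker_subtype])
  unfold hodgeNumber dolbeaultCohomology
  rw [e.finrank_eq, dolbeaultClosedForms_zero_zero_eq_span_const]
  exact finrank_span_singleton hne

/-- **`h^{0,0} = 1`**, binder form. [cite: Voisin2002, §2.3.3] -/
theorem hodgeNumber_zero_zero_eq_one [FiniteDimensional ℂ E] [CompactSpace M] [ConnectedSpace M] :
    hodgeNumber E M 0 0 = 1 :=
  hodgeNumber_zero_zero_holds (E := E) (M := M)

end HodgeNumber

end Literature.NumberTheory.Transcendental

end
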